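import Mathlib.Analysis.SpecificLimits.Normed
import Mathlib.Analysis.SpecialFunctions.Log.Deriv
import Mathlib.Analysis.Complex.ExponentialBounds
import Mathlib.Analysis.Real.Pi.Bounds
import Mathlib.NumberTheory.ZetaValues
import Literature.NumberTheory.EllipticCurves.TateSeriesFormal
import HarnessLib

/-!
# Growth of the coefficients of `(q·j(q))^k`: `0 ≤ cₖ(n) ≤ exp(56 √(kn) + 27 k)`

Everything in this file is **proved**; there are no new definitions.  For the integer formal power
series `formalXJ = q·j(q) = E₄³/∏(1 - qᵐ)²⁴ = 1 + 744 q + 196884 q² + ⋯ ∈ ℤ⟦q⟧`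
(`TateSeriesFormal.lean`) and its powers we prove

* `coeff_formalXJ_pow_nonneg : 0 ≤ coeff n (formalXJ ^ k)` — all coefficients are non-negative;
* `coeff_formalXJ_pow_le_exp : ((coeff n (formalXJ ^ k) : ℤ) : ℝ) ≤ exp (56 √(k n) + 27 k)` for all
  `k, n` — the sub-exponential growth `log c(n) = O(√n)` of the coefficients of `j`
  (K. Mahler's estimate `c(n) ≤ e^{C√n}` used in Barré-Sirieix–Diaz–Gramain–Philibert's proof of
  the Mahler–Manin conjecture with the "naïve denominator" `z·J(z)`: Nesterenko–Philippon,
  LNM 1752, Ch. 2, §2.1, remark before Prop. 2.2), in the uniform-in-`k` form needed for Siegel's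
  lemma applied to the monomials `z^{λ₁} (zJ(z))^{λ₂}`.

## Proof (elementary majorants, no complex analysis)

All series involved have non-negative coefficients, so for real `0 ≤ x < 1` the `n`-th coefficient
of `φ` is at most `x⁻ⁿ Σ_{m ≤ n} coeff_m(φ) xᵐ`, and truncated sums are sub-multiplicative
(`truncSum_mul_le`).  Modulo `q^{n+1}`, `formalXJ ≡ E₄³ · ∏_{m ≤ n} (Σ_i q^{mi})²⁴`
(`coeff_formalXJ_pow_eq`), whence non-negativity, and the truncated sums are bounded by
`E₄(x)³ ∏_{m ≤ n} (1 - xᵐ)^{-24}` with `E₄(x) ≤ 1 + 240 Σ m⁴ xᵐ ≤ 5761 (1 - x)^{-5}` and, by the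
logarithmic series and `Σ 1/k² = π²/6` (Apostol's argument for `p(n) ≤ e^{π√(2n/3)}`),
`∏_{m ≤ n} (1 - xᵐ)^{-1} ≤ exp((π²/6) · x/(1 - x))`.  The choice `1/(1 - x) = 1 + √(n/k)` gives the
bound.

## References

* [NesterenkoPhilippon2001] Yu. V. Nesterenko, P. Philippon (eds.), *Introduction to Algebraic
  Independence Theory*, LNM 1752, Springer 2001, Ch. 2 (G. Diaz), §2.1 (the estimate
  `c(n) ≤ e^{C₀√n}` of Mahler for the coefficients of `j`, used with the denominator `zJ(z)` in
  [BDGP]) and §2.5, first step.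
* T. M. Apostol, *Introduction to Analytic Number Theory*, Springer 1976, Thm. 14.5 (the
  elementary majorant `∏ (1 - xᵐ)^{-1} ≤ exp((π²/6) x/(1-x))`).
-/

noncomputable section

open Finset PowerSeries Real

namespace Literature.NumberTheory.EllipticCurves

/-! ### Truncated sums of power series with non-negative coefficients -/

/-- Sub-multiplicativity of truncated sums for series with non-negative coefficients:
`Σ_{m ≤ n} coeff_m(φψ) xᵐ ≤ (Σ_{m ≤ n} coeff_m(φ) xᵐ)(Σ_{m ≤ n} coeff_m(ψ) xᵐ)` for `x ≥ 0`.
[folklore] -/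
theorem truncSum_mul_le {φ ψ : PowerSeries ℤ} (hφ : ∀ m, 0 ≤ coeff m φ) (hψ : ∀ m, 0 ≤ coeff m ψ)
    {x : ℝ} (hx : 0 ≤ x) (n : ℕ) :
    ∑ m ∈ range (n + 1), ((coeff m (φ * ψ) : ℤ) : ℝ) * x ^ m ≤
      (∑ m ∈ range (n + 1), ((coeff m φ : ℤ) : ℝ) * x ^ m) *
        ∑ m ∈ range (n + 1), ((coeff m ψ : ℤ) : ℝ) * x ^ m := by
  -- expand both sides as sums over pairs
  have hL : ∑ m ∈ range (n + 1), ((coeff m (φ * ψ) : ℤ) : ℝ) * x ^ m =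
      ∑ p ∈ (range (n + 1)).sigma (fun m ↦ antidiagonal m),
        ((coeff p.2.1 φ : ℤ) : ℝ) * x ^ p.2.1 * (((coeff p.2.2 ψ : ℤ) : ℝ) * x ^ p.2.2) := by
    rw [sum_sigma]
    refine sum_congr rfl fun m _ ↦ ?_
    rw [coeff_mul, Int.cast_sum, sum_mul]
    refine sum_congr rfl fun kl hkl ↦ ?_
    rw [mem_antidiagonal] at hkl
    rw [Int.cast_mul, ← hkl, pow_add]
    ring
  rw [hL, sum_mul_sum, ← sum_product']
  -- the injection `(m, (k, l)) ↦ (k, l)` from the sigma type into the square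
  refine le_trans ?_ (sum_le_sum_of_subset_of_nonneg (s := ((range (n + 1)).sigma
      (fun m ↦ antidiagonal m)).image (fun p ↦ (p.2.1, p.2.2))) ?_ ?_)
  · rw [sum_image]
    rintro ⟨m, k, l⟩ hp ⟨m', k', l'⟩ hp' h
    simp only [Prod.mk.injEq] at h
    simp only [Finset.mem_sigma, mem_antidiagonal, mem_coe] at hp hp'
    obtain ⟨rfl, rfl⟩ := h
    obtain rfl : m = m' := by rw [← hp.2, ← hp'.2]
    rfl
  · intro kl hkl
    simp only [mem_image, Finset.mem_sigma, mem_range, mem_antidiagonal, Sigma.exists,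
      Prod.exists] at hkl
    obtain ⟨m, k, l, ⟨hm, hkl⟩, rfl⟩ := hkl
    simp only [mem_product, mem_range]
    omega
  · intro kl _ _
    have := hφ kl.1
    have := hψ kl.2
    positivity

/-- Truncated sums of powers: `Σ_{m ≤ n} coeff_m(φᵏ) xᵐ ≤ (Σ_{m ≤ n} coeff_m(φ) xᵐ)ᵏ`, given
non-negative coefficients. [folklore] -/
theorem coeff_pow_nonneg {φ : PowerSeries ℤ} (hφ : ∀ m, 0 ≤ coeff m φ) (k m : ℕ) :
    0 ≤ coeff m (φ ^ k) := by
  induction k generalizing m with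
  | zero => simp only [pow_zero, coeff_one]; split_ifs <;> norm_num
  | succ k ih =>
    rw [pow_succ, coeff_mul]
    exact sum_nonneg fun kl _ ↦ mul_nonneg (ih _) (hφ _)

/-- Coefficients of a product of series with non-negative coefficients are non-negative.
[folklore] -/
theorem coeff_mul_nonneg {φ ψ : PowerSeries ℤ} (hφ : ∀ m, 0 ≤ coeff m φ) (hψ : ∀ m, 0 ≤ coeff m ψ)
    (m : ℕ) : 0 ≤ coeff m (φ * ψ) := by
  rw [coeff_mul]
  exact sum_nonneg fun kl _ ↦ mul_nonneg (hφ _) (hψ _)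

/-- Coefficients of a finite product of series with non-negative coefficients are non-negative.
[folklore] -/
theorem coeff_prod_nonneg {ι : Type*} (s : Finset ι) {φ : ι → PowerSeries ℤ}
    (hφ : ∀ i ∈ s, ∀ m, 0 ≤ coeff m (φ i)) (m : ℕ) : 0 ≤ coeff m (∏ i ∈ s, φ i) := by
  classical
  induction s using Finset.induction_on generalizing m with
  | empty => simp only [prod_empty, coeff_one]; split_ifs <;> norm_num
  | insert a s has ih =>
    rw [prod_insert has]
    exact coeff_mul_nonneg (hφ a (mem_insert_self a s))
      (fun m ↦ ih (fun i hi ↦ hφ i (mem_insert_of_mem hi)) m) m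

/-- Truncated sums of powers are bounded by powers of truncated sums (non-negative coefficients,
`x ≥ 0`). [folklore] -/
theorem truncSum_pow_le {φ : PowerSeries ℤ} (hφ : ∀ m, 0 ≤ coeff m φ) {x : ℝ} (hx : 0 ≤ x)
    (n k : ℕ) :
    ∑ m ∈ range (n + 1), ((coeff m (φ ^ k) : ℤ) : ℝ) * x ^ m ≤
      (∑ m ∈ range (n + 1), ((coeff m φ : ℤ) : ℝ) * x ^ m) ^ k := by
  induction k with
  | zero =>
    rw [pow_zero, pow_zero, sum_range_succ', ]
    simp only [coeff_one, Nat.succ_ne_zero, ↓reduceIte, Int.cast_zero, zero_mul, sum_const_zero,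
      zero_add, pow_zero, mul_one, Int.cast_one, le_refl]
  | succ k ih =>
    rw [pow_succ, pow_succ]
    refine (truncSum_mul_le (coeff_pow_nonneg hφ k) hφ hx n).trans ?_
    gcongr
    exact sum_nonneg fun m _ ↦ mul_nonneg (Int.cast_nonneg (hφ m)) (pow_nonneg hx m)

/-- Truncated sums of finite products are bounded by products of truncated sums. [folklore] -/
theorem truncSum_prod_le {ι : Type*} (s : Finset ι) {φ : ι → PowerSeries ℤ}
    (hφ : ∀ i ∈ s, ∀ m, 0 ≤ coeff m (φ i)) {x : ℝ} (hx : 0 ≤ x) (n : ℕ) :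
    ∑ m ∈ range (n + 1), ((coeff m (∏ i ∈ s, φ i) : ℤ) : ℝ) * x ^ m ≤
      ∏ i ∈ s, ∑ m ∈ range (n + 1), ((coeff m (φ i) : ℤ) : ℝ) * x ^ m := by
  classical
  induction s using Finset.induction_on with
  | empty =>
    rw [prod_empty, prod_empty, sum_range_succ']
    simp only [coeff_one, Nat.succ_ne_zero, ↓reduceIte, Int.cast_zero, zero_mul, sum_const_zero,
      zero_add, pow_zero, mul_one, Int.cast_one, le_refl]
  | insert a s has ih =>
    rw [prod_insert has, prod_insert has]
    have ha := hφ a (mem_insert_self a s)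
    have hs : ∀ i ∈ s, ∀ m, 0 ≤ coeff m (φ i) := fun i hi ↦ hφ i (mem_insert_of_mem hi)
    refine (truncSum_mul_le ha (coeff_prod_nonneg s hs) hx n).trans ?_
    gcongr
    · exact sum_nonneg fun m _ ↦ mul_nonneg (Int.cast_nonneg (ha m)) (pow_nonneg hx m)
    · exact ih hs

/-- A single coefficient is bounded by the truncated sum: `coeff_n(φ) xⁿ ≤ Σ_{m ≤ n} coeff_m(φ) xᵐ`
(non-negative coefficients, `x ≥ 0`). [folklore] -/
theorem coeff_mul_pow_le_truncSum {φ : PowerSeries ℤ} (hφ : ∀ m, 0 ≤ coeff m φ) {x : ℝ}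
    (hx : 0 ≤ x) (n : ℕ) :
    ((coeff n φ : ℤ) : ℝ) * x ^ n ≤ ∑ m ∈ range (n + 1), ((coeff m φ : ℤ) : ℝ) * x ^ m := by
  have := single_le_sum (f := fun m ↦ ((coeff m φ : ℤ) : ℝ) * x ^ m) (s := range (n + 1))
    (fun m _ ↦ mul_nonneg (Int.cast_nonneg (hφ m)) (pow_nonneg hx m))
    (self_mem_range_succ n)
  exact this

/-- Truncated sums only see low coefficients: congruent series have equal truncated sums.
[folklore] -/
theorem truncSum_congr {φ ψ : PowerSeries ℤ} {n : ℕ} (h : ∀ m ≤ n, coeff m φ = coeff m ψ)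
    (x : ℝ) :
    ∑ m ∈ range (n + 1), ((coeff m φ : ℤ) : ℝ) * x ^ m = ∑ m ∈ range (n + 1), ((coeff m ψ : ℤ) : ℝ) * x ^ m :=
  sum_congr rfl fun m hm ↦ by rw [h m (Nat.lt_succ_iff.mp (mem_range.mp hm))]

/-! ### The geometric series `Σ_i q^{di}` and the inverse of `∏ (1 - qᵐ)²⁴` -/

/-- `(1 - q^d) · Σ_i q^{di} = 1` in `ℤ⟦q⟧` for `d ≥ 1`. [folklore] -/
theorem one_sub_X_pow_mul_geom {d : ℕ} (hd : d ≠ 0) :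
    (1 - (X : PowerSeries ℤ) ^ d) * PowerSeries.mk (fun j ↦ if d ∣ j then (1 : ℤ) else 0) = 1 := by
  ext j
  rw [sub_mul, one_mul, map_sub, coeff_mk, coeff_X_pow_mul', coeff_one]
  rcases eq_or_ne j 0 with rfl | hj
  · rw [if_pos (dvd_zero d), if_neg (by omega), if_pos rfl, sub_zero]
  · rw [if_neg hj]
    by_cases hdj : d ≤ j
    · rw [if_pos hdj, coeff_mk]
      have h' : d ∣ j ↔ d ∣ j - d := by
        conv_lhs => rw [← Nat.sub_add_cancel hdj]
        exact Nat.dvd_add_left dvd_rfl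
      by_cases hdvd : d ∣ j
      · rw [if_pos hdvd, if_pos (h'.mp hdvd), sub_self]
      · rw [if_neg hdvd, if_neg (mt h'.mpr hdvd), sub_zero]
    · rw [if_neg hdj, sub_zero, if_neg]
      exact Nat.not_dvd_of_pos_of_lt (Nat.pos_of_ne_zero hj) (not_le.mp hdj)

/-- The coefficients of `Σ_i q^{di}` are `0` or `1`, in particular non-negative. [folklore] -/
theorem coeff_geom_nonneg (d m : ℕ) :
    0 ≤ coeff m (PowerSeries.mk (fun j ↦ if d ∣ j then (1 : ℤ) else 0)) := by
  rw [coeff_mk]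
  split_ifs <;> norm_num

/-- `∏_{i<n} (1 - q^{i+1})²⁴ · ∏_{i<n} (Σ_j q^{(i+1)j})²⁴ = 1`. [folklore] -/
theorem deltaFactorProd_mul_geomProd (n : ℕ) :
    deltaFactorProd n *
        ∏ i ∈ range n, (PowerSeries.mk (fun j ↦ if (i + 1) ∣ j then (1 : ℤ) else 0)) ^ 24 = 1 := by
  rw [deltaFactorProd, ← prod_mul_distrib]
  refine prod_eq_one fun i _ ↦ ?_
  rw [← mul_pow, one_sub_X_pow_mul_geom (Nat.succ_ne_zero i), one_pow]

/-- **Modulo `q^{n+1}`, `(Δ/q)⁻¹ = ∏_{m ≥ 1} (1 - qᵐ)^{-24} ≡ ∏_{i<n} (Σ_j q^{(i+1)j})²⁴`.**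
[folklore] -/
theorem coeff_invOfUnit_formalDeltaUnit_eq {m n : ℕ} (hm : m ≤ n) :
    coeff m (PowerSeries.invOfUnit formalDeltaUnit 1) =
      coeff m (∏ i ∈ range n, (PowerSeries.mk (fun j ↦ if (i + 1) ∣ j then (1 : ℤ) else 0)) ^ 24) := by
  set I := ∏ i ∈ range n, (PowerSeries.mk (fun j ↦ if (i + 1) ∣ j then (1 : ℤ) else 0)) ^ 24
    with hI
  set Inv := PowerSeries.invOfUnit formalDeltaUnit 1 with hInv
  have hdvd : (X : PowerSeries ℤ) ^ (n + 1) ∣ deltaFactorProd n - formalDeltaUnit := by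
    rw [X_pow_dvd_iff]
    intro k hk
    rw [map_sub, coeff_formalDeltaUnit (Nat.lt_succ_iff.mp hk), sub_self]
  have h1 : formalDeltaUnit * Inv = 1 := formalDeltaUnit_mul_invOfUnit
  have h2 : deltaFactorProd n * I = 1 := deltaFactorProd_mul_geomProd n
  have hkey : Inv - I = Inv * I * (deltaFactorProd n - formalDeltaUnit) := by
    linear_combination I * h1 + (-Inv) * h2
  have hdvd' : (X : PowerSeries ℤ) ^ (n + 1) ∣ Inv - I := by
    rw [hkey]
    exact dvd_mul_of_dvd_right hdvd _
  rw [X_pow_dvd_iff] at hdvd'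
  have := hdvd' m (Nat.lt_succ_of_le hm)
  rwa [map_sub, sub_eq_zero] at this

/-- **Modulo `q^{n+1}`, `(q·j)ᵏ ≡ (E₄³ · ∏_{i<n} (Σ_j q^{(i+1)j})²⁴)ᵏ`** — a series with manifestly
non-negative coefficients. [folklore] -/
theorem coeff_formalXJ_pow_eq {m n : ℕ} (hm : m ≤ n) (k : ℕ) :
    coeff m (formalXJ ^ k) = coeff m ((formalE4 ^ 3 *
      ∏ i ∈ range n, (PowerSeries.mk (fun j ↦ if (i + 1) ∣ j then (1 : ℤ) else 0)) ^ 24) ^ k) := by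
  set I := ∏ i ∈ range n, (PowerSeries.mk (fun j ↦ if (i + 1) ∣ j then (1 : ℤ) else 0)) ^ 24
    with hI
  have hdvd : (X : PowerSeries ℤ) ^ (n + 1) ∣ formalXJ - formalE4 ^ 3 * I := by
    rw [formalXJ, ← mul_sub]
    refine dvd_mul_of_dvd_right ?_ _
    rw [X_pow_dvd_iff]
    intro k hk
    rw [map_sub, coeff_invOfUnit_formalDeltaUnit_eq (Nat.lt_succ_iff.mp hk), sub_self]
  have := dvd_trans hdvd (sub_dvd_pow_sub_pow _ _ k)
  rw [X_pow_dvd_iff] at this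
  have h := this m (Nat.lt_succ_of_le hm)
  rwa [map_sub, sub_eq_zero] at h

/-- The coefficients of `E₄ = 1 + 240 Σ σ₃(n) qⁿ` are non-negative. [folklore] -/
theorem coeff_formalE4_nonneg (m : ℕ) : 0 ≤ coeff m formalE4 := by
  rw [coeff_formalE4]
  split_ifs <;> positivity

/-- The coefficients of `E₄³ · ∏_{i<n} (Σ_j q^{(i+1)j})²⁴` are non-negative. [folklore] -/
theorem coeff_majorant_nonneg (n m : ℕ) : 0 ≤ coeff m (formalE4 ^ 3 *
      ∏ i ∈ range n, (PowerSeries.mk (fun j ↦ if (i + 1) ∣ j then (1 : ℤ) else 0)) ^ 24) :=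
  coeff_mul_nonneg (coeff_pow_nonneg coeff_formalE4_nonneg 3)
    (coeff_prod_nonneg _ fun i _ ↦ coeff_pow_nonneg (coeff_geom_nonneg (i + 1)) 24) m

/-- **All coefficients of `(q·j(q))ᵏ` are non-negative** (`j = 1/q + 744 + Σ c(n) qⁿ` with
`c(n) ∈ ℕ`, Nesterenko–Philippon Ch. 2 Prop. 2.1 (3)). [cite: NesterenkoPhilippon2001, Ch. 2, Prop. 2.1] -/
theorem coeff_formalXJ_pow_nonneg (k m : ℕ) : 0 ≤ coeff m (formalXJ ^ k) := by
  rw [coeff_formalXJ_pow_eq le_rfl k]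
  exact coeff_pow_nonneg (coeff_majorant_nonneg m) k m

/-- All coefficients `c(n)` of `q·j(q) = Σ c(n) qⁿ` are non-negative. [cite: NesterenkoPhilippon2001, Ch. 2, Prop. 2.1] -/
theorem coeff_formalXJ_nonneg (m : ℕ) : 0 ≤ coeff m formalXJ := by
  simpa using coeff_formalXJ_pow_nonneg 1 m

/-! ### Real majorants -/

open scoped ArithmeticFunction.sigma in
/-- `σ₃(m) ≤ m⁴`. [folklore] -/
theorem sigma_three_le_pow_four (m : ℕ) : σ 3 m ≤ m ^ 4 := by
  rw [ArithmeticFunction.sigma_apply]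
  calc ∑ d ∈ m.divisors, d ^ 3 ≤ ∑ d ∈ m.divisors, m ^ 3 :=
        sum_le_sum fun d hd ↦ Nat.pow_le_pow_left (Nat.divisor_le hd) 3
    _ = m.divisors.card * m ^ 3 := by rw [sum_const, smul_eq_mul]
    _ ≤ m * m ^ 3 := Nat.mul_le_mul_right _ (Nat.card_divisors_le_self m)
    _ = m ^ 4 := by ring

/-- `m⁴ ≤ 24 · C(m+4, 4) = (m+1)(m+2)(m+3)(m+4)`. [folklore] -/
theorem pow_four_le_choose (m : ℕ) : m ^ 4 ≤ 24 * (m + 4).choose 4 :=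
  calc m ^ 4 ≤ (m + 1) ^ 4 := Nat.pow_le_pow_left (Nat.le_succ m) 4
    _ ≤ (m + 1).ascFactorial 4 := Nat.pow_succ_le_ascFactorial (m + 1) 4
    _ = 24 * (m + 4).choose 4 := by rw [Nat.ascFactorial_eq_factorial_mul_choose]; rfl

open scoped ArithmeticFunction.sigma in
/-- Coefficient bound for `E₄`: `coeff_m(E₄) ≤ 5760 · C(m+4, 4)`. [folklore] -/
theorem coeff_formalE4_le (m : ℕ) :
    ((coeff m formalE4 : ℤ) : ℝ) ≤ 5760 * ((m + 4).choose 4 : ℝ) := by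
  rw [coeff_formalE4]
  split_ifs with hm
  · subst hm
    norm_num [Nat.choose_self]
  · have h : σ 3 m ≤ 24 * (m + 4).choose 4 := (sigma_three_le_pow_four m).trans (pow_four_le_choose m)
    have h' : ((σ 3 m : ℕ) : ℝ) ≤ 24 * ((m + 4).choose 4 : ℝ) := by exact_mod_cast h
    push_cast
    linarith

/-- Truncated sums of `E₄` on `[0, 1)`: `Σ_{m ≤ n} coeff_m(E₄) xᵐ ≤ 5760 / (1 - x)⁵`. [folklore] -/
theorem truncSum_formalE4_le {x : ℝ} (hx0 : 0 ≤ x) (hx1 : x < 1) (n : ℕ) :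
    ∑ m ∈ range (n + 1), ((coeff m formalE4 : ℤ) : ℝ) * x ^ m ≤ 5760 / (1 - x) ^ 5 := by
  have hsum : HasSum (fun m : ℕ ↦ ((m + 4).choose 4 : ℝ) * x ^ m) (1 / (1 - x) ^ 5) := by
    have hx : ‖x‖ < 1 := by rwa [Real.norm_eq_abs, abs_of_nonneg hx0]
    exact_mod_cast hasSum_choose_mul_geometric_of_norm_lt_one 4 hx
  calc ∑ m ∈ range (n + 1), ((coeff m formalE4 : ℤ) : ℝ) * x ^ m
      ≤ ∑ m ∈ range (n + 1), 5760 * (((m + 4).choose 4 : ℝ) * x ^ m) := by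
        refine sum_le_sum fun m _ ↦ ?_
        rw [← mul_assoc]
        exact mul_le_mul_of_nonneg_right (coeff_formalE4_le m) (pow_nonneg hx0 m)
    _ = 5760 * ∑ m ∈ range (n + 1), ((m + 4).choose 4 : ℝ) * x ^ m := by rw [mul_sum]
    _ ≤ 5760 * (1 / (1 - x) ^ 5) := by
        gcongr
        exact sum_le_hasSum _ (fun m _ ↦ by positivity) hsum
    _ = 5760 / (1 - x) ^ 5 := by ring

/-- Truncated sums of the geometric series `Σ_j q^{dj}` on `[0, 1)` are at most `1/(1 - x^d)`.
[folklore] -/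
theorem truncSum_geom_le {x : ℝ} (hx0 : 0 ≤ x) (hx1 : x < 1) {d : ℕ} (hd : d ≠ 0) (n : ℕ) :
    ∑ m ∈ range (n + 1),
        ((coeff m (PowerSeries.mk fun j ↦ if d ∣ j then (1 : ℤ) else 0) : ℤ) : ℝ) * x ^ m ≤
      1 / (1 - x ^ d) := by
  set f : ℕ → ℝ := fun m ↦
    ((coeff m (PowerSeries.mk fun j ↦ if d ∣ j then (1 : ℤ) else 0) : ℤ) : ℝ) * x ^ m with hfdef
  have hf : ∀ m, f m = if d ∣ m then x ^ m else 0 := fun m ↦ by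
    simp only [hfdef, coeff_mk]
    split_ifs <;> simp
  have hxd : x ^ d < 1 := pow_lt_one₀ hx0 hx1 hd
  have hgeom : HasSum (fun i : ℕ ↦ (x ^ d) ^ i) (1 / (1 - x ^ d)) := by
    rw [one_div]
    exact hasSum_geometric_of_lt_one (pow_nonneg hx0 d) hxd
  have hinj : Function.Injective (fun i : ℕ ↦ d * i) := mul_right_injective₀ hd
  have hsum : HasSum f (1 / (1 - x ^ d)) := by
    rw [← hinj.hasSum_iff]
    · convert hgeom using 1
      ext i
      simp only [Function.comp_apply, hf, if_pos (dvd_mul_right d i), pow_mul]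
    · intro m hm
      rw [hf, if_neg]
      rintro ⟨i, rfl⟩
      exact hm ⟨i, rfl⟩
  exact sum_le_hasSum _
    (fun m _ ↦ mul_nonneg (Int.cast_nonneg (coeff_geom_nonneg d m)) (pow_nonneg hx0 m)) hsum

/-- `(k+1) xᵏ (1 - x) ≤ 1 - x^{k+1}` on `[0, 1]`. [folklore] -/
theorem succ_mul_pow_mul_one_sub_le {x : ℝ} (hx0 : 0 ≤ x) (hx1 : x ≤ 1) (k : ℕ) :
    ((k : ℝ) + 1) * x ^ k * (1 - x) ≤ 1 - x ^ (k + 1) := by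
  have h : ∑ _i ∈ range (k + 1), x ^ k ≤ ∑ i ∈ range (k + 1), x ^ i :=
    sum_le_sum fun i hi ↦ pow_le_pow_of_le_one hx0 hx1 (Nat.lt_succ_iff.mp (mem_range.mp hi))
  rw [sum_const, card_range, nsmul_eq_mul] at h
  calc ((k : ℝ) + 1) * x ^ k * (1 - x) = (1 - x) * (((k + 1 : ℕ) : ℝ) * x ^ k) := by
        push_cast; ring
    _ ≤ (1 - x) * ∑ i ∈ range (k + 1), x ^ i :=
        mul_le_mul_of_nonneg_left h (sub_nonneg.mpr hx1)
    _ = 1 - x ^ (k + 1) := mul_neg_geom_sum x (k + 1)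

/-- `Σ_{i<n} (x^{k+1})^{i+1} ≤ x / ((k+1)(1-x))` for `0 < x < 1`. [folklore] -/
theorem sum_pow_pow_succ_le {x : ℝ} (hx0 : 0 < x) (hx1 : x < 1) (k n : ℕ) :
    ∑ i ∈ range n, (x ^ (k + 1)) ^ (i + 1) ≤ x / (((k : ℝ) + 1) * (1 - x)) := by
  set y := x ^ (k + 1) with hy
  have hy0 : 0 ≤ y := pow_nonneg hx0.le _
  have hy1 : y < 1 := pow_lt_one₀ hx0.le hx1 (Nat.succ_ne_zero k)
  have h1 : ∑ i ∈ range n, y ^ (i + 1) = y * ∑ i ∈ range n, y ^ i := by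
    rw [mul_sum]
    exact sum_congr rfl fun i _ ↦ by ring
  have h2 : ∑ i ∈ range n, y ^ i ≤ (1 - y)⁻¹ :=
    sum_le_hasSum _ (fun i _ ↦ pow_nonneg hy0 i) (hasSum_geometric_of_lt_one hy0 hy1)
  have h3 : ((k : ℝ) + 1) * x ^ k * (1 - x) ≤ 1 - y := succ_mul_pow_mul_one_sub_le hx0.le hx1.le k
  have h1x : 0 < 1 - x := sub_pos.mpr hx1
  have hpos : 0 < ((k : ℝ) + 1) * x ^ k * (1 - x) := by positivity
  have hx' : x ≠ 0 := hx0.ne'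
  have hk : (k : ℝ) + 1 ≠ 0 := by positivity
  calc ∑ i ∈ range n, y ^ (i + 1) = y * ∑ i ∈ range n, y ^ i := h1
    _ ≤ y * (1 - y)⁻¹ := mul_le_mul_of_nonneg_left h2 hy0
    _ ≤ y * (((k : ℝ) + 1) * x ^ k * (1 - x))⁻¹ :=
        mul_le_mul_of_nonneg_left (inv_anti₀ hpos h3) hy0
    _ = x / (((k : ℝ) + 1) * (1 - x)) := by
        rw [hy]
        field_simp
        ring

/-- **Apostol's majorant**: `Σ_{i<n} -log(1 - x^{i+1}) ≤ (π²/6) · x/(1-x)` for `0 < x < 1` (expand the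
logarithms, interchange, and use `Σ_{i<n} x^{k i} ≤ x/(k(1-x))`, `Σ 1/k² = π²/6`). [folklore] -/
theorem sum_neg_log_one_sub_pow_le {x : ℝ} (hx0 : 0 < x) (hx1 : x < 1) (n : ℕ) :
    ∑ i ∈ range n, -Real.log (1 - x ^ (i + 1)) ≤ π ^ 2 / 6 * (x / (1 - x)) := by
  have hlog : ∀ i ∈ range n, HasSum (fun k : ℕ ↦ (x ^ (i + 1)) ^ (k + 1) / (k + 1))
      (-Real.log (1 - x ^ (i + 1))) := by
    intro i _
    refine Real.hasSum_pow_div_log_of_abs_lt_one ?_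
    rw [abs_of_nonneg (pow_nonneg hx0.le _)]
    exact pow_lt_one₀ hx0.le hx1 (Nat.succ_ne_zero i)
  have hS : HasSum (fun k : ℕ ↦ ∑ i ∈ range n, (x ^ (i + 1)) ^ (k + 1) / (k + 1))
      (∑ i ∈ range n, -Real.log (1 - x ^ (i + 1))) := hasSum_sum hlog
  have h1x : 0 < 1 - x := sub_pos.mpr hx1
  have hmaj : ∀ k : ℕ, ∑ i ∈ range n, (x ^ (i + 1)) ^ (k + 1) / (k + 1) ≤
      x / (1 - x) * (1 / ((k : ℝ) + 1) ^ 2) := by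
    intro k
    have hk : (0 : ℝ) < k + 1 := by positivity
    calc ∑ i ∈ range n, (x ^ (i + 1)) ^ (k + 1) / (k + 1)
        = (∑ i ∈ range n, (x ^ (k + 1)) ^ (i + 1)) / (k + 1) := by
          rw [sum_div]
          refine sum_congr rfl fun i _ ↦ ?_
          rw [← pow_mul, ← pow_mul, mul_comm]
      _ ≤ x / (((k : ℝ) + 1) * (1 - x)) / (k + 1) := by
          gcongr
          exact sum_pow_pow_succ_le hx0 hx1 k n
      _ = x / (1 - x) * (1 / ((k : ℝ) + 1) ^ 2) := by
          field_simp
  have hzeta : HasSum (fun k : ℕ ↦ 1 / ((k : ℝ) + 1) ^ 2) (π ^ 2 / 6) := by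
    have := (hasSum_nat_add_iff' 1).mpr hasSum_zeta_two
    simpa using this
  have hmajsum : HasSum (fun k : ℕ ↦ x / (1 - x) * (1 / ((k : ℝ) + 1) ^ 2))
      (x / (1 - x) * (π ^ 2 / 6)) := hzeta.mul_left _
  calc ∑ i ∈ range n, -Real.log (1 - x ^ (i + 1)) ≤ x / (1 - x) * (π ^ 2 / 6) :=
        hasSum_le hmaj hS hmajsum
    _ = π ^ 2 / 6 * (x / (1 - x)) := mul_comm _ _

/-- `∏_{i<n} (1 - x^{i+1})^{-24} ≤ exp(4π² x/(1-x))` for `0 < x < 1`. [folklore] -/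
theorem prod_inv_one_sub_pow_le {x : ℝ} (hx0 : 0 < x) (hx1 : x < 1) (n : ℕ) :
    ∏ i ∈ range n, (1 / (1 - x ^ (i + 1))) ^ 24 ≤ Real.exp (4 * π ^ 2 * (x / (1 - x))) := by
  have hpos : ∀ i, 0 < 1 - x ^ (i + 1) := fun i ↦
    sub_pos.mpr (pow_lt_one₀ hx0.le hx1 (Nat.succ_ne_zero i))
  have heq : ∏ i ∈ range n, (1 / (1 - x ^ (i + 1))) ^ 24 =
      Real.exp (24 * ∑ i ∈ range n, -Real.log (1 - x ^ (i + 1))) := by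
    rw [mul_sum, Real.exp_sum]
    refine prod_congr rfl fun i _ ↦ ?_
    rw [one_div, ← Real.log_inv,
      show (24 : ℝ) * Real.log (1 - x ^ (i + 1))⁻¹ = ((24 : ℕ) : ℝ) * Real.log (1 - x ^ (i + 1))⁻¹ by
        norm_num,
      ← Real.log_pow, Real.exp_log (pow_pos (inv_pos.mpr (hpos i)) 24)]
  rw [heq, Real.exp_le_exp]
  have := sum_neg_log_one_sub_pow_le hx0 hx1 n
  linarith

/-- **Truncated majorant of `(q·j)ᵏ`**: for `0 < x < 1` and all `n, k`,
`coeff_n((q·j)ᵏ) · xⁿ ≤ ((5760/(1-x)⁵)³ · exp(4π² x/(1-x)))ᵏ`. [folklore] -/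
theorem coeff_formalXJ_pow_mul_pow_le {x : ℝ} (hx0 : 0 < x) (hx1 : x < 1) (n k : ℕ) :
    ((coeff n (formalXJ ^ k) : ℤ) : ℝ) * x ^ n ≤
      ((5760 / (1 - x) ^ 5) ^ 3 * Real.exp (4 * π ^ 2 * (x / (1 - x)))) ^ k := by
  set G : ℕ → PowerSeries ℤ := fun i ↦ PowerSeries.mk fun j ↦ if (i + 1) ∣ j then (1 : ℤ) else 0
    with hG
  have hGnn : ∀ i m, 0 ≤ coeff m (G i) := fun i ↦ coeff_geom_nonneg (i + 1)
  have hGpnn : ∀ i m, 0 ≤ coeff m (G i ^ 24) := fun i ↦ coeff_pow_nonneg (hGnn i) 24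
  have hPnn : ∀ m, 0 ≤ coeff m (∏ i ∈ range n, G i ^ 24) :=
    coeff_prod_nonneg _ fun i _ ↦ hGpnn i
  have hE4nn : ∀ m, 0 ≤ coeff m (formalE4 ^ 3) := coeff_pow_nonneg coeff_formalE4_nonneg 3
  set Φ := formalE4 ^ 3 * ∏ i ∈ range n, G i ^ 24 with hΦ
  have hΦnn : ∀ m, 0 ≤ coeff m Φ := coeff_mul_nonneg hE4nn hPnn
  -- non-negativity of the various truncated sums
  have hT : ∀ {ψ : PowerSeries ℤ}, (∀ m, 0 ≤ coeff m ψ) →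
      0 ≤ ∑ m ∈ range (n + 1), ((coeff m ψ : ℤ) : ℝ) * x ^ m := fun hψ ↦
    sum_nonneg fun m _ ↦ mul_nonneg (Int.cast_nonneg (hψ m)) (pow_nonneg hx0.le m)
  have h1x : 0 < 1 - x := sub_pos.mpr hx1
  calc ((coeff n (formalXJ ^ k) : ℤ) : ℝ) * x ^ n
      = ((coeff n (Φ ^ k) : ℤ) : ℝ) * x ^ n := by rw [coeff_formalXJ_pow_eq le_rfl k]
    _ ≤ ∑ m ∈ range (n + 1), ((coeff m (Φ ^ k) : ℤ) : ℝ) * x ^ m :=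
        coeff_mul_pow_le_truncSum (coeff_pow_nonneg hΦnn k) hx0.le n
    _ ≤ (∑ m ∈ range (n + 1), ((coeff m Φ : ℤ) : ℝ) * x ^ m) ^ k :=
        truncSum_pow_le hΦnn hx0.le n k
    _ ≤ ((5760 / (1 - x) ^ 5) ^ 3 * Real.exp (4 * π ^ 2 * (x / (1 - x)))) ^ k := by
        refine pow_le_pow_left₀ (hT hΦnn) ?_ k
        calc ∑ m ∈ range (n + 1), ((coeff m Φ : ℤ) : ℝ) * x ^ m
            ≤ (∑ m ∈ range (n + 1), ((coeff m (formalE4 ^ 3) : ℤ) : ℝ) * x ^ m) *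
                ∑ m ∈ range (n + 1), ((coeff m (∏ i ∈ range n, G i ^ 24) : ℤ) : ℝ) * x ^ m :=
              truncSum_mul_le hE4nn hPnn hx0.le n
          _ ≤ (∑ m ∈ range (n + 1), ((coeff m formalE4 : ℤ) : ℝ) * x ^ m) ^ 3 *
                ∏ i ∈ range n, (∑ m ∈ range (n + 1), ((coeff m (G i) : ℤ) : ℝ) * x ^ m) ^ 24 := by
              refine mul_le_mul (truncSum_pow_le coeff_formalE4_nonneg hx0.le n 3) ?_ (hT hPnn)
                (pow_nonneg (hT coeff_formalE4_nonneg) 3)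
              calc ∑ m ∈ range (n + 1), ((coeff m (∏ i ∈ range n, G i ^ 24) : ℤ) : ℝ) * x ^ m
                  ≤ ∏ i ∈ range n, ∑ m ∈ range (n + 1), ((coeff m (G i ^ 24) : ℤ) : ℝ) * x ^ m :=
                    truncSum_prod_le _ (fun i _ ↦ hGpnn i) hx0.le n
                _ ≤ ∏ i ∈ range n, (∑ m ∈ range (n + 1), ((coeff m (G i) : ℤ) : ℝ) * x ^ m) ^ 24 :=
                    prod_le_prod (fun i _ ↦ hT (hGpnn i))
                      fun i _ ↦ truncSum_pow_le (hGnn i) hx0.le n 24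
          _ ≤ (5760 / (1 - x) ^ 5) ^ 3 * ∏ i ∈ range n, (1 / (1 - x ^ (i + 1))) ^ 24 := by
              refine mul_le_mul (pow_le_pow_left₀ (hT coeff_formalE4_nonneg)
                (truncSum_formalE4_le hx0.le hx1 n) 3) ?_ ?_ (by positivity)
              · exact prod_le_prod (fun i _ ↦ pow_nonneg (hT (hGnn i)) 24) fun i _ ↦
                  pow_le_pow_left₀ (hT (hGnn i)) (truncSum_geom_le hx0.le hx1 (Nat.succ_ne_zero i) n) 24
              · exact prod_nonneg fun i _ ↦ pow_nonneg (hT (hGnn i)) 24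
          _ ≤ (5760 / (1 - x) ^ 5) ^ 3 * Real.exp (4 * π ^ 2 * (x / (1 - x))) := by
              gcongr
              exact prod_inv_one_sub_pow_le hx0 hx1 n

/-- `5760 ≤ e⁹`. [folklore] -/
theorem numeral_le_exp_nine : (5760 : ℝ) ≤ Real.exp 9 := by
  have h := Real.exp_one_gt_d9
  have h9 : Real.exp 9 = Real.exp 1 ^ 9 := by rw [← Real.exp_nat_mul]; norm_num
  rw [h9]
  have : (2.7182818283 : ℝ) ^ 9 ≤ Real.exp 1 ^ 9 := by gcongr
  refine le_trans ?_ this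
  norm_num

/-- **Growth of the coefficients of `(q·j(q))ᵏ`**: for all `k, n`,
`coeff_n((q·j)ᵏ) ≤ exp(56 √(kn) + 27 k)`.  For `k = 1` this is Mahler's estimate `c(n) ≤ e^{C√n}`
for the coefficients of `j` (Nesterenko–Philippon Ch. 2 §2.1); the uniform version bounds the
entries of the linear system of the first step of the proof of the Mahler–Manin conjecture with the
denominator `zJ(z)`. [cite: NesterenkoPhilippon2001, Ch. 2, §2.1] -/
theorem coeff_formalXJ_pow_le_exp (k n : ℕ) :
    ((coeff n (formalXJ ^ k) : ℤ) : ℝ) ≤ Real.exp (56 * Real.sqrt (k * n) + 27 * k) := by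
  rcases Nat.eq_zero_or_pos k with rfl | hk
  · simp only [pow_zero, coeff_one, CharP.cast_eq_zero, zero_mul, Real.sqrt_zero, mul_zero,
      add_zero, Real.exp_zero]
    split_ifs <;> norm_num
  rcases Nat.eq_zero_or_pos n with rfl | hn
  · rw [coeff_zero_eq_constantCoeff_apply, map_pow, constantCoeff_formalXJ, one_pow, Int.cast_one]
    exact Real.one_le_exp (by positivity)
  -- `a = √n`, `b = √k`, `s = a/b = √(n/k)`, `u = 1 + s`, `x = 1 - 1/u = s/(1+s)`
  have hk' : (0 : ℝ) < k := Nat.cast_pos.mpr hk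
  have hn' : (0 : ℝ) < n := Nat.cast_pos.mpr hn
  set a := Real.sqrt n with ha
  set b := Real.sqrt k with hb
  have ha0 : 0 < a := Real.sqrt_pos.mpr hn'
  have hb0 : 0 < b := Real.sqrt_pos.mpr hk'
  have hab : Real.sqrt (k * n) = a * b := by
    rw [Real.sqrt_mul hk'.le, mul_comm]
  have ha2 : a ^ 2 = n := Real.sq_sqrt hn'.le
  have hb2 : b ^ 2 = k := Real.sq_sqrt hk'.le
  set s := a / b with hs
  have hs0 : 0 < s := div_pos ha0 hb0
  set x := s / (1 + s) with hx
  have hx0 : 0 < x := div_pos hs0 (by positivity)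
  have hx1 : x < 1 := (div_lt_one (by positivity)).mpr (lt_one_add s)
  have h1x : 1 - x = 1 / (1 + s) := by
    rw [hx]; field_simp; ring
  have hxx : x / (1 - x) = s := by
    rw [h1x, hx]; field_simp
  have hmain := coeff_formalXJ_pow_mul_pow_le hx0 hx1 n k
  rw [hxx, h1x] at hmain
  -- rewrite the majorant
  have hB : ((5760 / (1 / (1 + s)) ^ 5) ^ 3 * Real.exp (4 * π ^ 2 * s)) ^ k =
      (5760 : ℝ) ^ (3 * k) * (1 + s) ^ (15 * k) * Real.exp (4 * π ^ 2 * s * k) := by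
    have hA : ((5760 : ℝ) / (1 / (1 + s)) ^ 5) ^ 3 = (5760 : ℝ) ^ 3 * (1 + s) ^ 15 := by
      have : (1 : ℝ) + s ≠ 0 := by positivity
      field_simp
    rw [hA, show (4 : ℝ) * π ^ 2 * s * k = k * (4 * π ^ 2 * s) by ring, Real.exp_nat_mul, pow_mul,
      pow_mul, mul_pow, mul_pow]
  rw [hB] at hmain
  -- the four exponential bounds
  have hsk : s * k = a * b := by
    rw [hs, ← hb2]; field_simp
  have hns : n / s = a * b := by
    rw [hs, ← ha2]; field_simp
  have e1 : (5760 : ℝ) ^ (3 * k) ≤ Real.exp (27 * k) := by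
    calc (5760 : ℝ) ^ (3 * k) ≤ Real.exp 9 ^ (3 * k) := by gcongr; exact numeral_le_exp_nine
      _ = Real.exp (27 * k) := by rw [← Real.exp_nat_mul]; push_cast; ring_nf
  have e2 : (1 + s) ^ (15 * k) ≤ Real.exp (15 * (a * b)) := by
    calc (1 + s) ^ (15 * k) ≤ Real.exp s ^ (15 * k) := by
          gcongr; linarith [Real.add_one_le_exp s]
      _ = Real.exp (15 * (a * b)) := by
          rw [← Real.exp_nat_mul, ← hsk]; push_cast; ring_nf
  have e3 : Real.exp (4 * π ^ 2 * s * k) ≤ Real.exp (40 * (a * b)) := by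
    rw [Real.exp_le_exp, mul_assoc, hsk]
    have hπ : π ^ 2 < 10 := by nlinarith [Real.pi_lt_d2, Real.pi_pos]
    nlinarith [mul_pos ha0 hb0]
  have e4 : (x ^ n)⁻¹ ≤ Real.exp (a * b) := by
    have hxinv : x⁻¹ = 1 + 1 / s := by
      rw [hx]
      field_simp
      ring
    calc (x ^ n)⁻¹ = x⁻¹ ^ n := by rw [inv_pow]
      _ ≤ Real.exp (1 / s) ^ n := by
          rw [hxinv]; gcongr; linarith [Real.add_one_le_exp (1 / s)]
      _ = Real.exp (a * b) := by
          rw [← Real.exp_nat_mul, ← hns]; congr 1; field_simp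
  -- conclusion
  have hxn : 0 < x ^ n := pow_pos hx0 n
  calc ((coeff n (formalXJ ^ k) : ℤ) : ℝ)
      = ((coeff n (formalXJ ^ k) : ℤ) : ℝ) * x ^ n * (x ^ n)⁻¹ := by
        rw [mul_inv_cancel_right₀ hxn.ne']
    _ ≤ (5760 : ℝ) ^ (3 * k) * (1 + s) ^ (15 * k) * Real.exp (4 * π ^ 2 * s * k) * (x ^ n)⁻¹ :=
        mul_le_mul_of_nonneg_right hmain (inv_nonneg.mpr hxn.le)
    _ ≤ Real.exp (27 * k) * Real.exp (15 * (a * b)) * Real.exp (40 * (a * b)) * Real.exp (a * b) := by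
        gcongr
    _ = Real.exp (56 * Real.sqrt (k * n) + 27 * k) := by
        rw [← Real.exp_add, ← Real.exp_add, ← Real.exp_add, hab]
        ring_nf

/-- **Mahler's estimate for the coefficients of `j`**: `0 ≤ c(n) ≤ exp(56 √n + 27)` for the
coefficients `c(n)` of `q·j(q) = Σ c(n) qⁿ`. [cite: NesterenkoPhilippon2001, Ch. 2, §2.1] -/
theorem coeff_formalXJ_le_exp (n : ℕ) :
    ((coeff n formalXJ : ℤ) : ℝ) ≤ Real.exp (56 * Real.sqrt n + 27) := by
  simpa using coeff_formalXJ_pow_le_exp 1 n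

end Literature.NumberTheory.EllipticCurves

end
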